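import Mathlib.Algebra.Group.Prod
import Mathlib.Algebra.Order.BigOperators.Group.Finset
import Mathlib.Algebra.BigOperators.Ring.Finset
import Mathlib.Data.Finset.Prod
import Mathlib.Data.Fintype.Card
import Mathlib.Tactic.Group
import Literature.Combinatorics.Additive.TripleProductProperty
import Literature.Computability.AlgebraicComplexity.CohnUmansTPP

/-!
# The box bound for TPP triples in direct products `Q × A` (`A` finite abelian)

ω-census, family (b3) (single TPP triples in small groups); tpp lane (THEOREM D of sr-tpp-search-g15, FAT-THEORY.md §1;
restyled for the tree by sr-tpp-search-g19).  Framing: lottery ticket; floor = certified bounds/negative ranges.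

Let `Q` be any group, `A` a finite **abelian** group and `(S, T, U)` finite subsets of `Q × A` with the triple product
property (`Literature.Combinatorics.Additive.TripleProductProperty`, Cohn–Umans 2003 Def. 2.1).  Write a triple
`(s, t, u) ∈ S × T × U` as `((q₁,a), (q₂,b), (q₃,c))`; its *cell* is `(q₁, q₂, q₃)` and its *A-product* is `a b c`.
Two cells `P, P'` *interact* when the `Q`-part of the TPP word, `cellWord P P' = q₁ q₁'⁻¹ (q₂ q₂'⁻¹) (q₃ q₃'⁻¹)`, is
trivial; a set of cells is *independent* when no ordered pair of distinct members interacts (stated inline as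
`∀ P ∈ I, ∀ P' ∈ I, P ≠ P' → cellWord P P' ≠ 1`; no `Prop`-valued definition is introduced).

**Theorem (`box_bound`).**  If every independent set of cells inside the box `X × Y × W` (`X, Y, W` = the
`Q`-projections of `S, T, U`) has at most `k` elements, then `|S| |T| |U| ≤ k · |A|`.

*Proof.*  Fibre `S × T × U` by the A-product.  Inside one fibre, two triples with the same cell have trivial TPP word
(the `Q`-part is `cellWord P P = 1`, the `A`-part is `x x⁻¹ = 1` because `A` is commutative), so they coincide by
TPP: the cell map is injective on each fibre; and two triples of one fibre with *distinct* cells cannot interact for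
the same reason, so the cells of a fibre form an independent set inside the box, of size `≤ k`.  Summing over the
`|A|` fibres gives the bound. ∎

Corollaries: `volume_le_of_indep_bound` (global constant: if every independent cell set of `Q` has `≤ k` elements
then every TPP triple of `Q × A` has `|S||T||U| ≤ k |A|`) and `not_realizesTPP_prod_of_indep_bound` (`Q × A` does
not realize `⟨N₁, N₂, N₃⟩` when `k |A| < N₁ N₂ N₃`).  The lane used the box form with machine-computed constants
(`α_{S₃}(6,3,3) = 10`, `α_{Dic₃}(12,3,3) = 20`) to exclude census frontier cells (`(32,3,3)` in `S₃ × C₂₈`,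
`(34,3,3)` in `Dic₃ × C₁₅`, `(35,3,3)` in `S₃ × C₃₁`); those constants are NOT kernel-checked here — this file
certifies the reduction only.  Elementary new mathematics of the cell (not a published statement): it lives under
`Summits/`, not `Literature/`.
-/

open Finset
open Literature.Combinatorics.Additive

namespace Summit.MatrixMultiplication.OmegaCensus.ProductBoxBound

variable {Q A : Type*} [Group Q] [CommGroup A] [DecidableEq Q] [DecidableEq A]

/-- The `Q`-part of the TPP word of two cells of coset representatives. -/
def cellWord (P P' : Q × Q × Q) : Q :=
  P.1 * P'.1⁻¹ * (P.2.1 * P'.2.1⁻¹) * (P.2.2 * P'.2.2⁻¹)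

omit [DecidableEq Q] in
/-- A cell does not interact with itself non-trivially: `cellWord P P = 1`. [folklore] -/
@[simp] theorem cellWord_self (P : Q × Q × Q) : cellWord P P = 1 := by
  simp [cellWord]

/-- the cell (triple of `Q`-components) of a triple of elements of `Q × A` -/
def cell (v : (Q × A) × (Q × A) × (Q × A)) : Q × Q × Q := (v.1.1, v.2.1.1, v.2.2.1)

/-- the `A`-product of a triple of elements of `Q × A` -/
def aprod (v : (Q × A) × (Q × A) × (Q × A)) : A := v.1.2 * v.2.1.2 * v.2.2.2

omit [DecidableEq Q] [DecidableEq A] in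
/-- The `Q`-component of the TPP word of two triples is the cell word of their cells. [folklore] -/
theorem word_fst (s s' t t' u u' : Q × A) :
    (s * s'⁻¹ * (t * t'⁻¹) * (u * u'⁻¹)).1 = cellWord (s.1, t.1, u.1) (s'.1, t'.1, u'.1) := by
  simp [cellWord]

omit [DecidableEq Q] [DecidableEq A] in
/-- The `A`-component of the TPP word of two triples is the quotient of their `A`-products (`A` abelian).
[folklore] -/
theorem word_snd (s s' t t' u u' : Q × A) :
    (s * s'⁻¹ * (t * t'⁻¹) * (u * u'⁻¹)).2 = (s.2 * t.2 * u.2) * (s'.2 * t'.2 * u'.2)⁻¹ := by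
  simp only [Prod.snd_mul, Prod.snd_inv, mul_inv_rev]
  simp only [mul_assoc, mul_comm, mul_left_comm]

omit [DecidableEq Q] [DecidableEq A] in
/-- Key step: two triples of `S × T × U` with the same `A`-product whose cells have trivial
cell word are equal. -/
theorem eq_of_aprod_eq_of_cellWord {S T U : Finset (Q × A)} (h : TripleProductProperty S T U)
    {v v' : (Q × A) × (Q × A) × (Q × A)}
    (hv : v.1 ∈ S ∧ v.2.1 ∈ T ∧ v.2.2 ∈ U) (hv' : v'.1 ∈ S ∧ v'.2.1 ∈ T ∧ v'.2.2 ∈ U)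
    (hap : aprod v = aprod v') (hw : cellWord (cell v) (cell v') = 1) : v = v' := by
  obtain ⟨hs, ht, hu⟩ := hv
  obtain ⟨hs', ht', hu'⟩ := hv'
  have he : v.1 * v'.1⁻¹ * (v.2.1 * v'.2.1⁻¹) * (v.2.2 * v'.2.2⁻¹) = 1 := by
    refine Prod.ext ?_ ?_
    · rw [word_fst]; exact hw
    · rw [word_snd]
      change aprod v * (aprod v')⁻¹ = 1
      rw [hap, mul_inv_cancel]
  obtain ⟨h1, h2, h3⟩ := h v.1 hs v'.1 hs' v.2.1 ht v'.2.1 ht' v.2.2 hu v'.2.2 hu' he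
  exact Prod.ext h1 (Prod.ext h2 h3)

/-- **Theorem D (box theorem).**  For a TPP triple `(S,T,U)` in `Q × A` with `A` finite abelian:
if every independent set of cells inside the box of `Q`-projections has at most `k` elements, then
`|S| |T| |U| ≤ k |A|`. -/
theorem box_bound [Fintype A] (S T U : Finset (Q × A)) (h : TripleProductProperty S T U) (k : ℕ)
    (hk : ∀ I : Finset (Q × Q × Q),
      I ⊆ (S.image Prod.fst) ×ˢ ((T.image Prod.fst) ×ˢ (U.image Prod.fst)) → (∀ P ∈ I, ∀ P' ∈ I, P ≠ P' → cellWord P P' ≠ 1) → #I ≤ k) :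
    #S * #T * #U ≤ k * Fintype.card A := by
  set V := S ×ˢ (T ×ˢ U) with hV
  have hmemV : ∀ v ∈ V, v.1 ∈ S ∧ v.2.1 ∈ T ∧ v.2.2 ∈ U := by
    intro v hv
    simp only [V, mem_product] at hv
    exact ⟨hv.1, hv.2.1, hv.2.2⟩
  have hcardV : #V = #S * #T * #U := by
    simp [V, card_product, Nat.mul_assoc]
  -- each fibre of the A-product has at most k elements
  have hfib : ∀ x : A, #(V.filter (fun v => aprod v = x)) ≤ k := by
    intro x
    set Vx := V.filter (fun v => aprod v = x) with hVx
    have hmemVx : ∀ v ∈ Vx, (v.1 ∈ S ∧ v.2.1 ∈ T ∧ v.2.2 ∈ U) ∧ aprod v = x := by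
      intro v hv
      rw [hVx, mem_filter] at hv
      exact ⟨hmemV v hv.1, hv.2⟩
    -- the cell map is injective on the fibre
    have hinj : Set.InjOn cell (Vx : Set ((Q × A) × (Q × A) × (Q × A))) := by
      intro v hv v' hv' hc
      have H := hmemVx v hv
      have H' := hmemVx v' hv'
      exact eq_of_aprod_eq_of_cellWord h H.1 H'.1 (H.2.trans H'.2.symm)
        (by rw [hc, cellWord_self])
    rw [← card_image_of_injOn hinj]
    apply hk
    · -- the cells of the fibre lie in the box
      intro P hP
      rw [mem_image] at hP
      obtain ⟨v, hv, rfl⟩ := hP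
      have H := (hmemVx v hv).1
      simp only [cell, mem_product, mem_image]
      exact ⟨⟨v.1, H.1, rfl⟩, ⟨v.2.1, H.2.1, rfl⟩, ⟨v.2.2, H.2.2, rfl⟩⟩
    · -- and form an independent set
      intro P hP P' hP' hne hw
      rw [mem_image] at hP hP'
      obtain ⟨v, hv, rfl⟩ := hP
      obtain ⟨v', hv', rfl⟩ := hP'
      have H := hmemVx v hv
      have H' := hmemVx v' hv'
      have := eq_of_aprod_eq_of_cellWord h H.1 H'.1 (H.2.trans H'.2.symm) hw
      exact hne (by rw [this])
  calc #S * #T * #U = #V := hcardV.symm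
    _ = ∑ x : A, #(V.filter (fun v => aprod v = x)) :=
        card_eq_sum_card_fiberwise (f := aprod) (fun v _ => mem_univ (aprod v))
    _ ≤ ∑ _x : A, k := sum_le_sum (fun x _ => hfib x)
    _ = k * Fintype.card A := by simp [Nat.mul_comm]

/-- Global form: `β*(Q)`-type constant.  If every independent set of cells of `Q` has at most
`k` elements, every TPP triple of `Q × A` has volume `≤ k |A|`. -/
theorem volume_le_of_indep_bound [Fintype A] (k : ℕ)
    (hk : ∀ I : Finset (Q × Q × Q), (∀ P ∈ I, ∀ P' ∈ I, P ≠ P' → cellWord P P' ≠ 1) → #I ≤ k)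
    (S T U : Finset (Q × A)) (h : TripleProductProperty S T U) :
    #S * #T * #U ≤ k * Fintype.card A :=
  box_bound S T U h k (fun I _ hI => hk I hI)

/-- Corollary: `Q × A` does not realize `⟨N₁, N₂, N₃⟩` when `k |A| < N₁ N₂ N₃`. -/
theorem not_realizesTPP_prod_of_indep_bound [Fintype Q] [Fintype A] (k N₁ N₂ N₃ : ℕ)
    (hk : ∀ I : Finset (Q × Q × Q), (∀ P ∈ I, ∀ P' ∈ I, P ≠ P' → cellWord P P' ≠ 1) → #I ≤ k)
    (hlt : k * Fintype.card A < N₁ * N₂ * N₃) :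
    ¬ Literature.Computability.AlgebraicComplexity.RealizesTPP (Q × A) N₁ N₂ N₃ := by
  rintro ⟨S, T, U, hS, hT, hU, h⟩
  have := volume_le_of_indep_bound k hk S T U h
  rw [hS, hT, hU] at this
  omega

end Summit.MatrixMultiplication.OmegaCensus.ProductBoxBound
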